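import Summits.AtomisticToContinuum.FouriersLaw.Theorems.HeatModeWeylLawSpecificHeatLimitIdentities
import Summits.AtomisticToContinuum.FouriersLaw.Theorems.HeatModeWeylLawSpecificHeatLimitMoments
import Summits.AtomisticToContinuum.FouriersLaw.Theorems.HeatModeWeylLawSpecificHeatLimitCovariance
import Mathlib.Analysis.SpecificLimits.Basic
import HarnessLib

/-!
# Assembly lemmas for the configurational specific heat: partition-function asymptotics, the
# identification of the bond covariances, and the final real-analysis step

Helper file for item `stmt-AtomisticToContinuum-12398` (`SpecificHeatLimit`, route `HeatModeWeylLaw`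
of `AtomisticToContinuum/FouriersLaw`); the pieces of `confVariance_div_tendsto`
(`…SpecificHeatLimitLimit.lean`) that do not depend on the construction of the transfer operator:

* `tendsto_inner_pow_div` — `⟪b, Aⁿ b⟫ / λⁿ → ⟪φ, b⟫²` from the geometric convergence of the powers;
* `norm_pow_apply_le_two_mul_pow`, `boundary_ratio_le` — `‖Aⁿ b‖ ≤ 2 λⁿ ‖b‖` and the uniform bound
  `(⟪bU, Aⁿ b⟫ + ⟪b, Aⁿ bU⟫)/(2 ⟪b, Aⁿ b⟫) ≤ 2 ‖b‖ ‖bU‖ / z_*` on the boundary second moments;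
* `exists_pos_le_of_tendsto` — a positive sequence with positive limit is bounded below;
* `tendsto_div_succ_of_abs_sub_le` — if `|V n - CS n| ≤ K + 2√(K · CS n)`, `CS n ≥ 0` and
  `CS n / n → σ²`, then `σ² ≥ 0` and `V n / (n+1) → σ²`;
* `sum_cov_eq_sum_range` — in the setting of `gibbsMoments_eq_inner` with `A` symmetric, the double
  sum of the bond-energy covariances under the configurational Gibbs measure equals the double sum of
  the transfer-operator covariances `e2 n l m - e1 n l · e1 n m`, and the boundary second moments are
  `(⟪bU, Aⁿ b⟫ + ⟪b, Aⁿ bU⟫)/(2⟪b, Aⁿ b⟫)`.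

All [folklore]; no definitions.
-/

noncomputable section

open MeasureTheory ProbabilityTheory Set Filter Topology Function
open scoped RealInnerProductSpace ENNReal

namespace Summit.AtomisticToContinuum.FouriersLaw.Theorems.SpecificHeatLimit

open Literature.MathematicalPhysics.KineticTheory.HeatConduction Literature.Analysis.OperatorTheory

/-! ### Abstract Hilbert-space bookkeeping -/

section Abstract

variable {E : Type*} [NormedAddCommGroup E] [InnerProductSpace ℝ E] {A : E →L[ℝ] E} {φ b : E}
  {lam θ : ℝ}

/-- `‖Aⁿ b‖ ≤ 2 λⁿ ‖b‖` from `‖Aⁿ b - λⁿ⟪φ, b⟫φ‖ ≤ θⁿ ‖b‖`, `θ ≤ λ`, `‖φ‖ = 1`. [folklore] -/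
theorem norm_pow_apply_le_two_mul_pow (hφ : ‖φ‖ = 1) (hlam : 0 < lam) (hθ0 : 0 ≤ θ) (hθ : θ ≤ lam)
    (hpow : ∀ (n : ℕ) (g : E), ‖(A ^ n) g - (lam ^ n * ⟪φ, g⟫) • φ‖ ≤ θ ^ n * ‖g‖) (n : ℕ) :
    ‖(A ^ n) b‖ ≤ 2 * lam ^ n * ‖b‖ := by
  have hcb : |⟪φ, b⟫| ≤ ‖b‖ := by
    calc |⟪φ, b⟫| ≤ ‖φ‖ * ‖b‖ := abs_real_inner_le_norm _ _
      _ = ‖b‖ := by rw [hφ, one_mul]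
  calc ‖(A ^ n) b‖ = ‖((A ^ n) b - (lam ^ n * ⟪φ, b⟫) • φ) + (lam ^ n * ⟪φ, b⟫) • φ‖ := by
        rw [sub_add_cancel]
    _ ≤ ‖(A ^ n) b - (lam ^ n * ⟪φ, b⟫) • φ‖ + ‖(lam ^ n * ⟪φ, b⟫) • φ‖ := norm_add_le _ _
    _ ≤ θ ^ n * ‖b‖ + lam ^ n * ‖b‖ := by
        refine add_le_add (hpow n b) ?_
        rw [norm_smul, hφ, mul_one, Real.norm_eq_abs, abs_mul, abs_of_pos (pow_pos hlam n)]
        exact mul_le_mul_of_nonneg_left hcb (pow_pos hlam n).le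
    _ ≤ lam ^ n * ‖b‖ + lam ^ n * ‖b‖ := by
        gcongr
    _ = 2 * lam ^ n * ‖b‖ := by ring

/-- **Uniform bound on the boundary second moments**: with `⟪b, Aⁿ b⟫ ≥ z_* λⁿ`,
`(⟪bU, Aⁿ b⟫ + ⟪b, Aⁿ bU⟫)/(2 ⟪b, Aⁿ b⟫) ≤ 2 ‖b‖ ‖bU‖ / z_*`. [folklore] -/
theorem boundary_ratio_le (hA : ∀ x y, ⟪A x, y⟫ = ⟪x, A y⟫) (hφ : ‖φ‖ = 1) (hlam : 0 < lam)
    (hθ0 : 0 ≤ θ) (hθ : θ ≤ lam)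
    (hpow : ∀ (n : ℕ) (g : E), ‖(A ^ n) g - (lam ^ n * ⟪φ, g⟫) • φ‖ ≤ θ ^ n * ‖g‖) {zs : ℝ}
    (hzs : 0 < zs) (hz : ∀ n, zs * lam ^ n ≤ ⟪b, (A ^ n) b⟫) (bU : E) (n : ℕ) :
    (⟪bU, (A ^ n) b⟫ + ⟪b, (A ^ n) bU⟫) / (2 * ⟪b, (A ^ n) b⟫) ≤ 2 * ‖b‖ * ‖bU‖ / zs := by
  have hZ : 0 < ⟪b, (A ^ n) b⟫ := (mul_pos hzs (pow_pos hlam n)).trans_le (hz n)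
  have hAnb := norm_pow_apply_le_two_mul_pow (b := b) hφ hlam hθ0 hθ hpow n
  have h1 : |⟪bU, (A ^ n) b⟫| ≤ ‖bU‖ * (2 * lam ^ n * ‖b‖) :=
    (abs_real_inner_le_norm _ _).trans (by gcongr)
  have h2 : |⟪b, (A ^ n) bU⟫| ≤ ‖bU‖ * (2 * lam ^ n * ‖b‖) := by
    rw [← inner_pow_apply_comm hA, ← real_inner_comm]
    exact (abs_real_inner_le_norm _ _).trans (by gcongr)
  rw [div_le_div_iff₀ (by positivity) hzs]
  calc (⟪bU, (A ^ n) b⟫ + ⟪b, (A ^ n) bU⟫) * zs ≤ (|⟪bU, (A ^ n) b⟫| + |⟪b, (A ^ n) bU⟫|) * zs := by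
        gcongr <;> exact le_abs_self _
    _ ≤ (‖bU‖ * (2 * lam ^ n * ‖b‖) + ‖bU‖ * (2 * lam ^ n * ‖b‖)) * zs := by gcongr
    _ = 2 * ‖b‖ * ‖bU‖ * (2 * (zs * lam ^ n)) := by ring
    _ ≤ 2 * ‖b‖ * ‖bU‖ * (2 * ⟪b, (A ^ n) b⟫) := by gcongr; exact hz n

/-- **The partition functions per power of the top eigenvalue converge**:
`⟪b, Aⁿ b⟫ / λⁿ → ⟪φ, b⟫²` (`0 ≤ θ < λ`). [folklore] -/
theorem tendsto_inner_pow_div (hlam : 0 < lam) (hθ0 : 0 ≤ θ) (hθ : θ < lam)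
    (hpow : ∀ (n : ℕ) (g : E), ‖(A ^ n) g - (lam ^ n * ⟪φ, g⟫) • φ‖ ≤ θ ^ n * ‖g‖) :
    Tendsto (fun n => ⟪b, (A ^ n) b⟫ / lam ^ n) atTop (𝓝 (⟪φ, b⟫ ^ 2)) := by
  have hbd : ∀ n, |⟪b, (A ^ n) b⟫ / lam ^ n - ⟪φ, b⟫ ^ 2| ≤ (θ / lam) ^ n * ‖b‖ ^ 2 := by
    intro n
    have hln : 0 < lam ^ n := pow_pos hlam n
    have h1 : ⟪b, (A ^ n) b⟫ - lam ^ n * ⟪φ, b⟫ ^ 2 = ⟪b, (A ^ n) b - (lam ^ n * ⟪φ, b⟫) • φ⟫ := by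
      rw [inner_sub_right, real_inner_smul_right, real_inner_comm φ b, sq]; ring
    have h2 : |⟪b, (A ^ n) b⟫ - lam ^ n * ⟪φ, b⟫ ^ 2| ≤ θ ^ n * ‖b‖ ^ 2 := by
      rw [h1]
      calc |⟪b, (A ^ n) b - (lam ^ n * ⟪φ, b⟫) • φ⟫| ≤ ‖b‖ * ‖(A ^ n) b - (lam ^ n * ⟪φ, b⟫) • φ‖ :=
            abs_real_inner_le_norm _ _
        _ ≤ ‖b‖ * (θ ^ n * ‖b‖) := by gcongr; exact hpow n b
        _ = θ ^ n * ‖b‖ ^ 2 := by ring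
    have e : ⟪b, (A ^ n) b⟫ / lam ^ n - ⟪φ, b⟫ ^ 2 =
        (⟪b, (A ^ n) b⟫ - lam ^ n * ⟪φ, b⟫ ^ 2) / lam ^ n := by
      field_simp
    rw [e, abs_div, abs_of_pos hln, div_le_iff₀ hln, div_pow]
    calc |⟪b, (A ^ n) b⟫ - lam ^ n * ⟪φ, b⟫ ^ 2| ≤ θ ^ n * ‖b‖ ^ 2 := h2
      _ = θ ^ n / lam ^ n * ‖b‖ ^ 2 * lam ^ n := by field_simp
  have hr : Tendsto (fun n => (θ / lam) ^ n * ‖b‖ ^ 2) atTop (𝓝 0) := by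
    have := (tendsto_pow_atTop_nhds_zero_of_lt_one (div_nonneg hθ0 hlam.le)
      ((div_lt_one hlam).2 hθ)).mul_const (‖b‖ ^ 2)
    simpa using this
  have h0 := squeeze_zero_norm (fun n => by rw [Real.norm_eq_abs]; exact hbd n) hr
  have := h0.add_const (⟪φ, b⟫ ^ 2)
  simpa using this

end Abstract

/-! ### Real-analysis bookkeeping -/

/-- A positive sequence with a positive limit is bounded below by a positive constant not exceeding
the limit. [folklore] -/
theorem exists_pos_le_of_tendsto {z : ℕ → ℝ} {L : ℝ} (hz : ∀ n, 0 < z n) (hL : 0 < L)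
    (ht : Tendsto z atTop (𝓝 L)) : ∃ zs : ℝ, 0 < zs ∧ zs ≤ L ∧ ∀ n, zs ≤ z n := by
  obtain ⟨N, hN⟩ := eventually_atTop.1 (ht.eventually (lt_mem_nhds (half_lt_self hL)))
  obtain ⟨n₀, -, hmin⟩ := (Finset.range (N + 1)).exists_min_image z ⟨0, by simp⟩
  refine ⟨min (L / 2) (z n₀), lt_min (half_pos hL) (hz n₀),
    (min_le_left _ _).trans (half_le_self hL.le), fun n => ?_⟩
  by_cases hn : n ≤ N
  · exact (min_le_right _ _).trans (hmin n (Finset.mem_range.2 (Nat.lt_succ_of_le hn)))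
  · exact (min_le_left _ _).trans (hN n (by omega)).le

/-- **The final real-analysis step.** If `|V n - CS n| ≤ K + 2 √(CS n · K)`, `CS n ≥ 0` and
`CS n / n → σ²`, then `σ² ≥ 0` and `V n / (n + 1) → σ²`. [folklore] -/
theorem tendsto_div_succ_of_abs_sub_le {V CS : ℕ → ℝ} {K σ2 : ℝ} (hCS : ∀ n, 0 ≤ CS n)
    (hb : ∀ n, |V n - CS n| ≤ K + 2 * Real.sqrt (CS n * K))
    (hlim : Tendsto (fun n : ℕ => CS n / n) atTop (𝓝 σ2)) :
    0 ≤ σ2 ∧ Tendsto (fun n : ℕ => V n / ((n : ℝ) + 1)) atTop (𝓝 σ2) := by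
  have hK : 0 ≤ K := by
    have h := hb 0
    have : Real.sqrt (CS 0 * K) ≤ Real.sqrt (CS 0 * |K|) :=
      Real.sqrt_le_sqrt (mul_le_mul_of_nonneg_left (le_abs_self K) (hCS 0))
    by_contra hK
    push Not at hK
    have h2 : Real.sqrt (CS 0 * K) = 0 := Real.sqrt_eq_zero'.2 (mul_nonpos_of_nonneg_of_nonpos (hCS 0) hK.le)
    rw [h2, mul_zero, add_zero] at h
    exact absurd (h.trans_lt hK) (not_lt.2 (abs_nonneg _))
  have hCS1 : Tendsto (fun n : ℕ => CS n / ((n : ℝ) + 1)) atTop (𝓝 σ2) := by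
    have h1 : Tendsto (fun n : ℕ => (n : ℝ) / ((n : ℝ) + 1)) atTop (𝓝 1) :=
      tendsto_natCast_div_add_atTop 1
    have h2 := hlim.mul h1
    rw [mul_one] at h2
    refine h2.congr' ?_
    filter_upwards [eventually_ge_atTop 1] with n hn
    have hn0 : (n : ℝ) ≠ 0 := by exact_mod_cast (by omega : n ≠ 0)
    field_simp
  have hσ2 : 0 ≤ σ2 := ge_of_tendsto' hCS1 fun n => div_nonneg (hCS n) (by positivity)
  refine ⟨hσ2, ?_⟩
  have hdiff : Tendsto (fun n : ℕ => (V n - CS n) / ((n : ℝ) + 1)) atTop (𝓝 0) := by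
    have hg : Tendsto (fun n : ℕ => K * (1 / ((n : ℝ) + 1)) +
        2 * Real.sqrt (K * (CS n / ((n : ℝ) + 1)) * (1 / ((n : ℝ) + 1)))) atTop (𝓝 0) := by
      have h0 : Tendsto (fun n : ℕ => 1 / ((n : ℝ) + 1)) atTop (𝓝 0) :=
        tendsto_one_div_add_atTop_nhds_zero_nat
      have := (h0.const_mul K).add (((hCS1.const_mul K).mul h0).sqrt.const_mul 2)
      simpa using this
    refine squeeze_zero_norm (fun n => ?_) hg
    have hn1 : (0 : ℝ) < (n : ℝ) + 1 := by positivity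
    rw [Real.norm_eq_abs, abs_div, abs_of_pos hn1]
    calc |V n - CS n| / ((n : ℝ) + 1) ≤ (K + 2 * Real.sqrt (CS n * K)) / ((n : ℝ) + 1) :=
          div_le_div_of_nonneg_right (hb n) hn1.le
      _ = K * (1 / ((n : ℝ) + 1)) + 2 * Real.sqrt (K * (CS n / ((n : ℝ) + 1)) * (1 / ((n : ℝ) + 1))) := by
          have e1 : K * (CS n / ((n : ℝ) + 1)) * (1 / ((n : ℝ) + 1)) = (CS n * K) / ((n : ℝ) + 1) ^ 2 := by
            field_simp
          rw [e1, Real.sqrt_div' _ (sq_nonneg _), Real.sqrt_sq hn1.le]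
          field_simp
  have := hCS1.add hdiff
  rw [add_zero] at this
  refine this.congr fun n => ?_
  ring

/-! ### Identification of the bond covariances with the transfer-operator covariances -/

section Identification

variable {P : OscillatorChain} {T : ℝ} {a : ℝ → ℝ} {k h : ℝ → ℝ → ℝ} {ρ : Measure ℝ}
  [IsFiniteMeasure ρ] {A H₁ H₂ : Lp ℝ 2 ρ →L[ℝ] Lp ℝ 2 ρ} {b bU : Lp ℝ 2 ρ} {C : ℝ} {n : ℕ}
  {ν : Measure (Fin (n + 1) → ℝ)}

/-- **The bond covariances under the configurational Gibbs measure are the transfer-operator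
covariances**, summed: `∑_{i,j<n} cov_ν(hᵢ, hⱼ) = ∑_{l,m<n} (e2 n l m - e1 n l · e1 n m)` with
`e1 n l = ⟪Aˡ b, H₁ A^{n-1-l} b⟫/⟪b, Aⁿ b⟫` and `e2 n l m` the symmetric two-point functions
(`H₁ … H₁` off the diagonal, `H₂` on it), and the boundary second moments are
`(𝔼_ν U(q₀)² + 𝔼_ν U(qₙ)²)/2 = (⟪bU, Aⁿ b⟫ + ⟪b, Aⁿ bU⟫)/(2⟪b, Aⁿ b⟫)` — by `gibbsMoments_eq_inner`,
`confMeasure_spec` and `abs_variance_potential_sub_sum_cov_le`. [folklore] -/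
theorem sum_cov_eq_sum_range (hT : 0 < T) (hU0 : ∀ x, 0 ≤ P.U x) (hV0 : ∀ r, 0 ≤ P.V r)
    (hUc : Continuous P.U) (hVc : Continuous P.V) (ha : ∀ x, a x = Real.exp (-P.U x / (4 * T)))
    (hint : Integrable fun x => a x ^ 2) (hab : ∀ x, ‖a x‖ ≤ 1)
    (hk : ∀ x y, k x y = a x * Real.exp (-P.V (y - x) / T) * a y)
    (hh : ∀ x y, h x y = (P.U x + P.U y) / 2 + P.V (y - x))
    (hρ : ρ = volume.withDensity fun x => ENNReal.ofReal (a x ^ 2))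
    (hkm : Measurable (uncurry k)) (hkb : ∀ x y, ‖k x y‖ ≤ C)
    (hkhm : Measurable (uncurry fun x y => k x y * h x y)) (hkhb : ∀ x y, ‖k x y * h x y‖ ≤ C)
    (hkh2m : Measurable (uncurry fun x y => k x y * h x y ^ 2))
    (hkh2b : ∀ x y, ‖k x y * h x y ^ 2‖ ≤ C)
    (hA : ∀ ψ : Lp ℝ 2 ρ, (A ψ : ℝ → ℝ) =ᵐ[ρ] fun x => ∫ y, k x y * ψ y ∂ρ)
    (hsymA : ∀ x y, ⟪A x, y⟫ = ⟪x, A y⟫)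
    (hH₁ : ∀ ψ : Lp ℝ 2 ρ, (H₁ ψ : ℝ → ℝ) =ᵐ[ρ] fun x => ∫ y, (k x y * h x y) * ψ y ∂ρ)
    (hH₂ : ∀ ψ : Lp ℝ 2 ρ, (H₂ ψ : ℝ → ℝ) =ᵐ[ρ] fun x => ∫ y, (k x y * h x y ^ 2) * ψ y ∂ρ)
    (hb : (b : ℝ → ℝ) =ᵐ[ρ] a) (hUab : ∀ x, ‖P.U x ^ 2 * a x‖ ≤ C)
    (hbU : (bU : ℝ → ℝ) =ᵐ[ρ] fun x => P.U x ^ 2 * a x)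
    (hν : ν = (ENNReal.ofReal (∫ q : Fin (n + 1) → ℝ, Real.exp (-P.potential (n + 1) q / T)))⁻¹ •
      volume.withDensity fun q => ENNReal.ofReal (Real.exp (-P.potential (n + 1) q / T)))
    (e1 : ℕ → ℕ → ℝ)
    (he1 : ∀ l, e1 n l = ⟪(A ^ l) b, H₁ ((A ^ (n - 1 - l)) b)⟫ / ⟪b, (A ^ n) b⟫)
    (e2 : ℕ → ℕ → ℕ → ℝ)
    (he2 : ∀ l m, l < m →
      e2 n l m = ⟪(A ^ l) b, H₁ ((A ^ (m - l - 1)) (H₁ ((A ^ (n - 1 - m)) b)))⟫ / ⟪b, (A ^ n) b⟫)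
    (he2s : ∀ l m, e2 n l m = e2 n m l)
    (he2d : ∀ l, e2 n l l = ⟪(A ^ l) b, H₂ ((A ^ (n - 1 - l)) b)⟫ / ⟪b, (A ^ n) b⟫) :
    (∑ i : Fin n, ∑ j : Fin n, cov[fun q : Fin (n + 1) → ℝ => h (q (Fin.castSucc i)) (q i.succ),
        fun q => h (q (Fin.castSucc j)) (q j.succ); ν] =
      ∑ l ∈ Finset.range n, ∑ m ∈ Finset.range n, (e2 n l m - e1 n l * e1 n m)) ∧
    ((∫ q, P.U (q 0) ^ 2 ∂ν) + ∫ q, P.U (q (Fin.last n)) ^ 2 ∂ν) / 2 =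
      (⟪bU, (A ^ n) b⟫ + ⟪b, (A ^ n) bU⟫) / (2 * ⟪b, (A ^ n) b⟫) := by
  obtain ⟨-, hcovE, -⟩ := abs_variance_potential_sub_sum_cov_le (P := P) (n := n) hT hU0 hV0 hUc hVc
    ha hint hh hν
  obtain ⟨-, -, hformula, -⟩ := confMeasure_spec (P := P) (n := n) hT hU0 hV0 hUc hVc ha hint hν
  obtain ⟨hZ, hS1, hS2, hS2d, hB0, hBn⟩ := gibbsMoments_eq_inner (P := P) hT.ne' ha hUc.measurable hab hk
    hρ hkm hkb hkhm hkhb hkh2m hkh2b hA hH₁ hH₂ hb hUab hbU n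
  -- one-point functions
  have he1i : ∀ i : Fin n, (∫ q : Fin (n + 1) → ℝ, h (q (Fin.castSucc i)) (q i.succ) *
      Real.exp (-P.potential (n + 1) q / T)) / ⟪b, (A ^ n) b⟫ = e1 n i := by
    intro i
    rw [hS1 i, he1, ← inner_pow_apply_comm hsymA]
  -- two-point functions
  have he2ij : ∀ i j : Fin n, (∫ q : Fin (n + 1) → ℝ, h (q (Fin.castSucc i)) (q i.succ) *
      h (q (Fin.castSucc j)) (q j.succ) * Real.exp (-P.potential (n + 1) q / T)) / ⟪b, (A ^ n) b⟫ =
        e2 n i j := by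
    intro i j
    rcases lt_trichotomy (i : ℕ) (j : ℕ) with hij | hij | hji
    · rw [hS2 i j hij, he2 _ _ hij, ← inner_pow_apply_comm hsymA]
    · have hij' : i = j := Fin.ext hij
      subst hij'
      have e : (fun q : Fin (n + 1) → ℝ => h (q (Fin.castSucc i)) (q i.succ) *
          h (q (Fin.castSucc i)) (q i.succ) * Real.exp (-P.potential (n + 1) q / T)) = fun q =>
          h (q (Fin.castSucc i)) (q i.succ) ^ 2 * Real.exp (-P.potential (n + 1) q / T) :=
        funext fun q => by ring
      rw [e, hS2d i, he2d, ← inner_pow_apply_comm hsymA]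
    · have e : (fun q : Fin (n + 1) → ℝ => h (q (Fin.castSucc i)) (q i.succ) *
          h (q (Fin.castSucc j)) (q j.succ) * Real.exp (-P.potential (n + 1) q / T)) = fun q =>
          h (q (Fin.castSucc j)) (q j.succ) * h (q (Fin.castSucc i)) (q i.succ) *
            Real.exp (-P.potential (n + 1) q / T) := funext fun q => by ring
      rw [e, hS2 j i hji, he2s, he2 _ _ hji, ← inner_pow_apply_comm hsymA]
  have hcov : ∀ i j : Fin n, cov[fun q : Fin (n + 1) → ℝ => h (q (Fin.castSucc i)) (q i.succ),
      fun q => h (q (Fin.castSucc j)) (q j.succ); ν] = e2 n i j - e1 n i * e1 n j := by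
    intro i j
    rw [hcovE i j, hformula, hformula, hformula, hZ, he2ij, he1i, he1i]
  refine ⟨?_, ?_⟩
  · simp_rw [hcov]
    have inner : ∀ i : Fin n, ∑ j : Fin n, (e2 n i j - e1 n i * e1 n j) =
        ∑ m ∈ Finset.range n, (e2 n i m - e1 n i * e1 n m) := fun i =>
      Fin.sum_univ_eq_sum_range (fun m => e2 n i m - e1 n i * e1 n m) n
    simp_rw [inner]
    exact Fin.sum_univ_eq_sum_range (fun l => ∑ m ∈ Finset.range n, (e2 n l m - e1 n l * e1 n m)) n
  · rw [hformula, hformula, hB0, hBn, hZ]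
    have hZ0 : ⟪b, (A ^ n) b⟫ ≠ 0 := by
      intro h0
      have := hformula (fun _ => 1)
      rw [hZ, h0, div_zero] at this
      obtain ⟨hprob, -⟩ := confMeasure_spec (P := P) (n := n) hT hU0 hV0 hUc hVc ha hint hν
      simp at this
    field_simp

end Identification

end Summit.AtomisticToContinuum.FouriersLaw.Theorems.SpecificHeatLimit

end
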